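import Summits.HodgeConjecture.HodgeConjecture.Theorems.HodgeLocusCensusSigmaFamilySmooth

/-!
# Hodge-locus census — THEOREM SM-∞, smoothness of the explicit (P′)-, (P)- and (TOP)-row members, uniformly in k′

certified instances and evidence bearing on the general Hodge conjecture; no claim.

ENGINE B gen 35 (record `ENGINEB-g35.md` §1.3 table of rows, §1.7).  Setting of the anchor `HodgeLocusCensusSigmaFamilySmooth`
(imported for `block_xy_scaled`, `block_ab_scaled`, `pert`): coordinates `a b : ℂ`, `x y : ℕ → ℂ` (only indices `< k` occur), `d = e + 3`,
`F₀ = Σ_{j<k} (y_j x_j^{e+2} + y_j^{e+3}) + a^{e+2} b + a b^{e+2}`, member `F_N = N·F₀ + F₁` with the row's coupling `F₁`.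
The hypotheses are the partial derivatives `∂F_N/∂a, ∂F_N/∂b, ∂F_N/∂x_i (i < k), ∂F_N/∂y_j (j < k)` written as `N·(∂F₀) + (∂F₁)`
with the `∂F₁` parts spelled out by cases on the index (`if`-branches); the conclusion: they do not all vanish at a point with
`(a, b, x_0..x_{k−1}, y_0..y_{k−1}) ≠ 0`.  Transcription check: `gen35/check_rows_partials.py` (hand-typed mirrors of the `if`-branches
vs implementation B's polynomial gradients `sminf_families.family(kind, k, d, N)` at exact Gaussian-integer points, k = 1..8, d = 4..8:
3870 points, 0 mismatches; a planted coefficient error is detected).  Proof = the anchor's perturbation argument verbatim.  Def-free.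

* row (P′), `k ≥ 3` (`row_Pprime_member_nonsingular`): `F₁ = y_0 x_0^{e} x_1² + y_1 x_1^{e} x_2² + a b x_0^{e+1}`; `M = 2e + 1 = 2d − 5`,
  smooth for real `N ≥ 4e + 3 = 4d − 9`;
* row (P), `k ≥ 1` (`row_P_member_nonsingular`): `F₁ = a b x_0^{e+1}`; `M = e + 1 = d − 2`, smooth for real `N ≥ 2e + 3 = 2d − 3`;
* row (TOP), any `k` (`F0_nonsingular`): the member is `F₀` itself (`N = 1`, `F₁ = 0`).
-/

namespace Summit.HodgeConjecture.HodgeConjecture.HodgeLocus.Census.SigmaFamilySmoothRowsP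

open Summit.HodgeConjecture.HodgeConjecture.HodgeLocus.Census.SigmaFamilySmooth

/-- Row (P′), `k ≥ 3`: the member `N·F₀ + (y_0 x_0^{e} x_1² + y_1 x_1^{e} x_2² + a b x_0^{e+1})` is non-singular for `e ≥ 1`,
real `N ≥ 4e + 3 = 4d − 9` (gradient weight `2e + 1`). -/
theorem row_Pprime_member_nonsingular (k : ℕ) (hk : 3 ≤ k) (e : ℕ) (he : 1 ≤ e) (N : ℝ) (hN : 4 * (e : ℝ) + 3 ≤ N)
    (a b : ℂ) (x y : ℕ → ℂ)
    (hne : ¬ (a = 0 ∧ b = 0 ∧ ∀ i < k, x i = 0 ∧ y i = 0)) :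
    ¬ ( (N : ℂ) * (b * (((e : ℂ) + 2) * a ^ (e + 1) + b ^ (e + 1))) + b * x 0 ^ (e + 1) = 0 ∧
        (N : ℂ) * (a * (a ^ (e + 1) + ((e : ℂ) + 2) * b ^ (e + 1))) + a * x 0 ^ (e + 1) = 0 ∧
        (∀ i < k, (N : ℂ) * (((e : ℂ) + 2) * x i ^ (e + 1) * y i) +
            (if i = 0 then (e : ℂ) * y 0 * x 0 ^ (e - 1) * x 1 ^ 2 + ((e : ℂ) + 1) * a * b * x 0 ^ e
             else if i = 1 then 2 * y 0 * x 0 ^ e * x 1 + (e : ℂ) * y 1 * x 1 ^ (e - 1) * x 2 ^ 2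
             else if i = 2 then 2 * y 1 * x 1 ^ e * x 2
             else 0) = 0) ∧
        (∀ j < k, (N : ℂ) * (x j ^ (e + 2) + ((e : ℂ) + 3) * y j ^ (e + 2)) +
            (if j = 0 then x 0 ^ e * x 1 ^ 2 else if j = 1 then x 1 ^ e * x 2 ^ 2 else 0) = 0) ) := by
  rintro ⟨Ha, Hb, Hx, Hy⟩
  -- the sup norm m over the 2k+2 coordinates and an index attaining it
  let f : ℕ → ℝ := fun n => if n = 0 then ‖a‖ else if n = 1 then ‖b‖ else if n < k + 2 then ‖x (n - 2)‖ else ‖y (n - 2 - k)‖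
  obtain ⟨n₀, hn₀, hmax⟩ := Finset.exists_max_image (Finset.range (2 * k + 2)) f ⟨0, by simp⟩
  have hn₀' : n₀ < 2 * k + 2 := Finset.mem_range.mp hn₀
  have key : ∀ n, n < 2 * k + 2 → f n ≤ f n₀ := fun n hn => hmax n (Finset.mem_range.mpr hn)
  generalize hm_def : f n₀ = m at key
  have hA : ‖a‖ ≤ m := by have h := key 0 (by omega); simpa [f] using h
  have hB : ‖b‖ ≤ m := by have h := key 1 (by omega); simpa [f] using h
  have hX : ∀ i < k, ‖x i‖ ≤ m := by
    intro i hi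
    have h := key (i + 2) (by omega)
    simp only [f, show ¬ (i + 2 = 0) from by omega, show ¬ (i + 2 = 1) from by omega, show i + 2 < k + 2 from by omega,
      if_false, if_true, Nat.add_sub_cancel] at h
    exact h
  have hY : ∀ i < k, ‖y i‖ ≤ m := by
    intro i hi
    have h := key (i + 2 + k) (by omega)
    simp only [f, show ¬ (i + 2 + k = 0) from by omega, show ¬ (i + 2 + k = 1) from by omega,
      show ¬ (i + 2 + k < k + 2) from by omega, if_false, show i + 2 + k - 2 - k = i from by omega] at h
    exact h
  have hm : 0 < m := by
    by_contra hle
    have hle' : m ≤ 0 := not_lt.mp hle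
    exact hne ⟨norm_le_zero_iff.mp (hA.trans hle'), norm_le_zero_iff.mp (hB.trans hle'),
      fun i hi => ⟨norm_le_zero_iff.mp ((hX i hi).trans hle'), norm_le_zero_iff.mp ((hY i hi).trans hle')⟩⟩
  -- numeric facts
  have heR : (0 : ℝ) ≤ (e : ℝ) := by positivity
  have hM : (0 : ℝ) ≤ 2 * (e : ℝ) + 1 := by linarith
  have hN' : 2 * (2 * (e : ℝ) + 1) < N := by linarith
  have hc : (0 : ℝ) < m ^ (e + 2) := pow_pos hm _
  have hpow3 : m ^ (e + 2) = m * m * m ^ (e - 1) * m := by rw [show e + 2 = (e - 1) + 3 by omega]; ring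
  have hne1 : ‖((e : ℂ) + 1)‖ = (e : ℝ) + 1 := by
    rw [show ((e : ℂ) + 1) = (((e + 1 : ℕ)) : ℂ) by push_cast; ring, Complex.norm_natCast, Nat.cast_add, Nat.cast_one]
  have hk0 : 0 < k := by omega
  have hk1 : 1 < k := by omega
  have hk2 : 2 < k := by omega
  have hpow2 : m ^ (e + 2) = m * m ^ (e - 1) * m ^ 2 := by rw [show e + 2 = (e - 1) + 3 by omega]; ring
  have he1R : (1 : ℝ) ≤ (e : ℝ) := by exact_mod_cast he
  have htwo : ‖(2 : ℂ)‖ = 2 := by norm_num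
  -- coupling bounds ≤ (2e+1) m^{e+2}
  have ca : ‖b * x 0 ^ (e + 1)‖ ≤ (2 * (e : ℝ) + 1) * m ^ (e + 2) := by
    calc ‖b * x 0 ^ (e + 1)‖ = ‖b‖ * ‖x 0‖ ^ (e + 1) := by rw [norm_mul, norm_pow]
      _ ≤ m * m ^ (e + 1) := by gcongr; exact hX 0 hk0
      _ = 1 * m ^ (e + 2) := by ring
      _ ≤ (2 * (e : ℝ) + 1) * m ^ (e + 2) := by gcongr; linarith
  have cb : ‖a * x 0 ^ (e + 1)‖ ≤ (2 * (e : ℝ) + 1) * m ^ (e + 2) := by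
    calc ‖a * x 0 ^ (e + 1)‖ = ‖a‖ * ‖x 0‖ ^ (e + 1) := by rw [norm_mul, norm_pow]
      _ ≤ m * m ^ (e + 1) := by gcongr; exact hX 0 hk0
      _ = 1 * m ^ (e + 2) := by ring
      _ ≤ (2 * (e : ℝ) + 1) * m ^ (e + 2) := by gcongr; linarith
  have cx : ∀ i < k, ‖(if i = 0 then (e : ℂ) * y 0 * x 0 ^ (e - 1) * x 1 ^ 2 + ((e : ℂ) + 1) * a * b * x 0 ^ e
             else if i = 1 then 2 * y 0 * x 0 ^ e * x 1 + (e : ℂ) * y 1 * x 1 ^ (e - 1) * x 2 ^ 2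
             else if i = 2 then 2 * y 1 * x 1 ^ e * x 2
             else 0)‖ ≤ (2 * (e : ℝ) + 1) * m ^ (e + 2) := by
    intro i hi
    split_ifs with h0 h1 h2
    · have t1 : ‖(e : ℂ) * y 0 * x 0 ^ (e - 1) * x 1 ^ 2‖ ≤ (e : ℝ) * m ^ (e + 2) := by
        calc ‖(e : ℂ) * y 0 * x 0 ^ (e - 1) * x 1 ^ 2‖ = (e : ℝ) * ‖y 0‖ * ‖x 0‖ ^ (e - 1) * ‖x 1‖ ^ 2 := by
              rw [norm_mul, norm_mul, norm_mul, norm_pow, norm_pow, Complex.norm_natCast]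
          _ ≤ (e : ℝ) * m * m ^ (e - 1) * m ^ 2 := by gcongr; exacts [hY 0 hk0, hX 0 hk0, hX 1 hk1]
          _ = (e : ℝ) * m ^ (e + 2) := by rw [hpow2]; ring
      have t2 : ‖((e : ℂ) + 1) * a * b * x 0 ^ e‖ ≤ ((e : ℝ) + 1) * m ^ (e + 2) := by
        calc ‖((e : ℂ) + 1) * a * b * x 0 ^ e‖ = ((e : ℝ) + 1) * ‖a‖ * ‖b‖ * ‖x 0‖ ^ e := by
              rw [norm_mul, norm_mul, norm_mul, norm_pow, hne1]
          _ ≤ ((e : ℝ) + 1) * m * m * m ^ e := by gcongr; exact hX 0 hk0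
          _ = ((e : ℝ) + 1) * m ^ (e + 2) := by ring
      calc _ ≤ ‖(e : ℂ) * y 0 * x 0 ^ (e - 1) * x 1 ^ 2‖ + ‖((e : ℂ) + 1) * a * b * x 0 ^ e‖ := norm_add_le _ _
        _ ≤ (e : ℝ) * m ^ (e + 2) + ((e : ℝ) + 1) * m ^ (e + 2) := add_le_add t1 t2
        _ = (2 * (e : ℝ) + 1) * m ^ (e + 2) := by ring
    · have t1 : ‖2 * y 0 * x 0 ^ e * x 1‖ ≤ 2 * m ^ (e + 2) := by
        calc ‖2 * y 0 * x 0 ^ e * x 1‖ = 2 * ‖y 0‖ * ‖x 0‖ ^ e * ‖x 1‖ := by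
              rw [norm_mul, norm_mul, norm_mul, norm_pow, htwo]
          _ ≤ 2 * m * m ^ e * m := by gcongr; exacts [hY 0 hk0, hX 0 hk0, hX 1 hk1]
          _ = 2 * m ^ (e + 2) := by ring
      have t2 : ‖(e : ℂ) * y 1 * x 1 ^ (e - 1) * x 2 ^ 2‖ ≤ (e : ℝ) * m ^ (e + 2) := by
        calc ‖(e : ℂ) * y 1 * x 1 ^ (e - 1) * x 2 ^ 2‖ = (e : ℝ) * ‖y 1‖ * ‖x 1‖ ^ (e - 1) * ‖x 2‖ ^ 2 := by
              rw [norm_mul, norm_mul, norm_mul, norm_pow, norm_pow, Complex.norm_natCast]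
          _ ≤ (e : ℝ) * m * m ^ (e - 1) * m ^ 2 := by gcongr; exacts [hY 1 hk1, hX 1 hk1, hX 2 hk2]
          _ = (e : ℝ) * m ^ (e + 2) := by rw [hpow2]; ring
      calc _ ≤ ‖2 * y 0 * x 0 ^ e * x 1‖ + ‖(e : ℂ) * y 1 * x 1 ^ (e - 1) * x 2 ^ 2‖ := norm_add_le _ _
        _ ≤ 2 * m ^ (e + 2) + (e : ℝ) * m ^ (e + 2) := add_le_add t1 t2
        _ ≤ (2 * (e : ℝ) + 1) * m ^ (e + 2) := by nlinarith [he1R, hc]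
    · calc ‖2 * y 1 * x 1 ^ e * x 2‖ = 2 * ‖y 1‖ * ‖x 1‖ ^ e * ‖x 2‖ := by
              rw [norm_mul, norm_mul, norm_mul, norm_pow, htwo]
        _ ≤ 2 * m * m ^ e * m := by gcongr; exacts [hY 1 hk1, hX 1 hk1, hX 2 hk2]
        _ = 2 * m ^ (e + 2) := by ring
        _ ≤ (2 * (e : ℝ) + 1) * m ^ (e + 2) := by gcongr; linarith [he1R]
    · rw [norm_zero]; positivity
  have cy : ∀ j < k, ‖(if j = 0 then x 0 ^ e * x 1 ^ 2 else if j = 1 then x 1 ^ e * x 2 ^ 2 else 0)‖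
             ≤ (2 * (e : ℝ) + 1) * m ^ (e + 2) := by
    intro j hj
    split_ifs with h0 h1
    · calc ‖x 0 ^ e * x 1 ^ 2‖ = ‖x 0‖ ^ e * ‖x 1‖ ^ 2 := by rw [norm_mul, norm_pow, norm_pow]
        _ ≤ m ^ e * m ^ 2 := by gcongr; exacts [hX 0 hk0, hX 1 hk1]
        _ = 1 * m ^ (e + 2) := by ring
        _ ≤ (2 * (e : ℝ) + 1) * m ^ (e + 2) := by gcongr; linarith
    · calc ‖x 1 ^ e * x 2 ^ 2‖ = ‖x 1‖ ^ e * ‖x 2‖ ^ 2 := by rw [norm_mul, norm_pow, norm_pow]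
        _ ≤ m ^ e * m ^ 2 := by gcongr; exacts [hX 1 hk1, hX 2 hk2]
        _ = 1 * m ^ (e + 2) := by ring
        _ ≤ (2 * (e : ℝ) + 1) * m ^ (e + 2) := by gcongr; linarith
    · rw [norm_zero]; positivity
  -- which coordinate attains the sup norm
  rcases Nat.lt_or_ge n₀ 2 with h01 | h2
  · have hab : ‖a‖ = m ∨ ‖b‖ = m := by
      interval_cases n₀
      · left; simpa [f] using hm_def
      · right; simpa [f] using hm_def
    rcases block_ab_scaled e he a b m hm hA hB hab with h | h
    · exact pert N _ _ _ _ hc hM hN' h ca Ha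
    · exact pert N _ _ _ _ hc hM hN' h cb Hb
  · rcases Nat.lt_or_ge n₀ (k + 2) with hx' | hy'
    · -- x (n₀ - 2) attains
      have hi : n₀ - 2 < k := by omega
      have h1 : ‖x (n₀ - 2)‖ = m := by
        simp only [f, show ¬ (n₀ = 0) from by omega, show ¬ (n₀ = 1) from by omega, hx', if_false, if_true] at hm_def
        exact hm_def
      rcases block_xy_scaled e he (x (n₀ - 2)) (y (n₀ - 2)) m hm (hX _ hi) (hY _ hi) (Or.inl h1) with h | h
      · exact pert N _ _ _ _ hc hM hN' h (cx _ hi) (Hx _ hi)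
      · exact pert N _ _ _ _ hc hM hN' h (cy _ hi) (Hy _ hi)
    · -- y (n₀ - 2 - k) attains
      have hi : n₀ - 2 - k < k := by omega
      have h1 : ‖y (n₀ - 2 - k)‖ = m := by
        simp only [f, show ¬ (n₀ = 0) from by omega, show ¬ (n₀ = 1) from by omega, show ¬ (n₀ < k + 2) from by omega,
          if_false] at hm_def
        exact hm_def
      rcases block_xy_scaled e he (x (n₀ - 2 - k)) (y (n₀ - 2 - k)) m hm (hX _ hi) (hY _ hi) (Or.inr h1) with h | h
      · exact pert N _ _ _ _ hc hM hN' h (cx _ hi) (Hx _ hi)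
      · exact pert N _ _ _ _ hc hM hN' h (cy _ hi) (Hy _ hi)

/-- Row (P), `k ≥ 1`: the member `N·F₀ + a b x_0^{e+1}` is non-singular for `e ≥ 1`, real `N ≥ 2e + 3 = 2d − 3`
(gradient weight `e + 1`). -/
theorem row_P_member_nonsingular (k : ℕ) (hk : 1 ≤ k) (e : ℕ) (he : 1 ≤ e) (N : ℝ) (hN : 2 * (e : ℝ) + 3 ≤ N)
    (a b : ℂ) (x y : ℕ → ℂ)
    (hne : ¬ (a = 0 ∧ b = 0 ∧ ∀ i < k, x i = 0 ∧ y i = 0)) :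
    ¬ ( (N : ℂ) * (b * (((e : ℂ) + 2) * a ^ (e + 1) + b ^ (e + 1))) + b * x 0 ^ (e + 1) = 0 ∧
        (N : ℂ) * (a * (a ^ (e + 1) + ((e : ℂ) + 2) * b ^ (e + 1))) + a * x 0 ^ (e + 1) = 0 ∧
        (∀ i < k, (N : ℂ) * (((e : ℂ) + 2) * x i ^ (e + 1) * y i) +
            (if i = 0 then ((e : ℂ) + 1) * a * b * x 0 ^ e else 0) = 0) ∧
        (∀ j < k, (N : ℂ) * (x j ^ (e + 2) + ((e : ℂ) + 3) * y j ^ (e + 2)) + 0 = 0) ) := by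
  rintro ⟨Ha, Hb, Hx, Hy⟩
  -- the sup norm m over the 2k+2 coordinates and an index attaining it
  let f : ℕ → ℝ := fun n => if n = 0 then ‖a‖ else if n = 1 then ‖b‖ else if n < k + 2 then ‖x (n - 2)‖ else ‖y (n - 2 - k)‖
  obtain ⟨n₀, hn₀, hmax⟩ := Finset.exists_max_image (Finset.range (2 * k + 2)) f ⟨0, by simp⟩
  have hn₀' : n₀ < 2 * k + 2 := Finset.mem_range.mp hn₀
  have key : ∀ n, n < 2 * k + 2 → f n ≤ f n₀ := fun n hn => hmax n (Finset.mem_range.mpr hn)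
  generalize hm_def : f n₀ = m at key
  have hA : ‖a‖ ≤ m := by have h := key 0 (by omega); simpa [f] using h
  have hB : ‖b‖ ≤ m := by have h := key 1 (by omega); simpa [f] using h
  have hX : ∀ i < k, ‖x i‖ ≤ m := by
    intro i hi
    have h := key (i + 2) (by omega)
    simp only [f, show ¬ (i + 2 = 0) from by omega, show ¬ (i + 2 = 1) from by omega, show i + 2 < k + 2 from by omega,
      if_false, if_true, Nat.add_sub_cancel] at h
    exact h
  have hY : ∀ i < k, ‖y i‖ ≤ m := by
    intro i hi
    have h := key (i + 2 + k) (by omega)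
    simp only [f, show ¬ (i + 2 + k = 0) from by omega, show ¬ (i + 2 + k = 1) from by omega,
      show ¬ (i + 2 + k < k + 2) from by omega, if_false, show i + 2 + k - 2 - k = i from by omega] at h
    exact h
  have hm : 0 < m := by
    by_contra hle
    have hle' : m ≤ 0 := not_lt.mp hle
    exact hne ⟨norm_le_zero_iff.mp (hA.trans hle'), norm_le_zero_iff.mp (hB.trans hle'),
      fun i hi => ⟨norm_le_zero_iff.mp ((hX i hi).trans hle'), norm_le_zero_iff.mp ((hY i hi).trans hle')⟩⟩
  -- numeric facts
  have heR : (0 : ℝ) ≤ (e : ℝ) := by positivity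
  have hM : (0 : ℝ) ≤ (e : ℝ) + 1 := by linarith
  have hN' : 2 * ((e : ℝ) + 1) < N := by linarith
  have hc : (0 : ℝ) < m ^ (e + 2) := pow_pos hm _
  have hpow3 : m ^ (e + 2) = m * m * m ^ (e - 1) * m := by rw [show e + 2 = (e - 1) + 3 by omega]; ring
  have hne1 : ‖((e : ℂ) + 1)‖ = (e : ℝ) + 1 := by
    rw [show ((e : ℂ) + 1) = (((e + 1 : ℕ)) : ℂ) by push_cast; ring, Complex.norm_natCast, Nat.cast_add, Nat.cast_one]
  have hk0 : 0 < k := by omega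
  have ca : ‖b * x 0 ^ (e + 1)‖ ≤ ((e : ℝ) + 1) * m ^ (e + 2) := by
    calc ‖b * x 0 ^ (e + 1)‖ = ‖b‖ * ‖x 0‖ ^ (e + 1) := by rw [norm_mul, norm_pow]
      _ ≤ m * m ^ (e + 1) := by gcongr; exact hX 0 hk0
      _ = 1 * m ^ (e + 2) := by ring
      _ ≤ ((e : ℝ) + 1) * m ^ (e + 2) := by gcongr; linarith
  have cb : ‖a * x 0 ^ (e + 1)‖ ≤ ((e : ℝ) + 1) * m ^ (e + 2) := by
    calc ‖a * x 0 ^ (e + 1)‖ = ‖a‖ * ‖x 0‖ ^ (e + 1) := by rw [norm_mul, norm_pow]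
      _ ≤ m * m ^ (e + 1) := by gcongr; exact hX 0 hk0
      _ = 1 * m ^ (e + 2) := by ring
      _ ≤ ((e : ℝ) + 1) * m ^ (e + 2) := by gcongr; linarith
  have cx : ∀ i < k, ‖(if i = 0 then ((e : ℂ) + 1) * a * b * x 0 ^ e else 0)‖ ≤ ((e : ℝ) + 1) * m ^ (e + 2) := by
    intro i hi
    split_ifs with h0
    · calc ‖((e : ℂ) + 1) * a * b * x 0 ^ e‖ = ((e : ℝ) + 1) * ‖a‖ * ‖b‖ * ‖x 0‖ ^ e := by
              rw [norm_mul, norm_mul, norm_mul, norm_pow, hne1]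
        _ ≤ ((e : ℝ) + 1) * m * m * m ^ e := by gcongr; exact hX 0 hk0
        _ = ((e : ℝ) + 1) * m ^ (e + 2) := by ring
    · rw [norm_zero]; positivity
  have cy : ∀ j < k, ‖(0 : ℂ)‖ ≤ ((e : ℝ) + 1) * m ^ (e + 2) := by
    intro j hj; rw [norm_zero]; positivity
  -- which coordinate attains the sup norm
  rcases Nat.lt_or_ge n₀ 2 with h01 | h2
  · have hab : ‖a‖ = m ∨ ‖b‖ = m := by
      interval_cases n₀
      · left; simpa [f] using hm_def
      · right; simpa [f] using hm_def
    rcases block_ab_scaled e he a b m hm hA hB hab with h | h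
    · exact pert N _ _ _ _ hc hM hN' h ca Ha
    · exact pert N _ _ _ _ hc hM hN' h cb Hb
  · rcases Nat.lt_or_ge n₀ (k + 2) with hx' | hy'
    · -- x (n₀ - 2) attains
      have hi : n₀ - 2 < k := by omega
      have h1 : ‖x (n₀ - 2)‖ = m := by
        simp only [f, show ¬ (n₀ = 0) from by omega, show ¬ (n₀ = 1) from by omega, hx', if_false, if_true] at hm_def
        exact hm_def
      rcases block_xy_scaled e he (x (n₀ - 2)) (y (n₀ - 2)) m hm (hX _ hi) (hY _ hi) (Or.inl h1) with h | h
      · exact pert N _ _ _ _ hc hM hN' h (cx _ hi) (Hx _ hi)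
      · exact pert N _ _ _ _ hc hM hN' h (cy _ hi) (Hy _ hi)
    · -- y (n₀ - 2 - k) attains
      have hi : n₀ - 2 - k < k := by omega
      have h1 : ‖y (n₀ - 2 - k)‖ = m := by
        simp only [f, show ¬ (n₀ = 0) from by omega, show ¬ (n₀ = 1) from by omega, show ¬ (n₀ < k + 2) from by omega,
          if_false] at hm_def
        exact hm_def
      rcases block_xy_scaled e he (x (n₀ - 2 - k)) (y (n₀ - 2 - k)) m hm (hX _ hi) (hY _ hi) (Or.inr h1) with h | h
      · exact pert N _ _ _ _ hc hM hN' h (cx _ hi) (Hx _ hi)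
      · exact pert N _ _ _ _ hc hM hN' h (cy _ hi) (Hy _ hi)

/-- Row (TOP): `F₀ = Σ_{j<k} (y_j x_j^{e+2} + y_j^{e+3}) + a^{e+2} b + a b^{e+2}` itself is non-singular (`e ≥ 1`, any `k`):
its partial derivatives do not all vanish at a point with `(a, b, x_0..x_{k−1}, y_0..y_{k−1}) ≠ 0`. -/
theorem F0_nonsingular (k : ℕ) (e : ℕ) (he : 1 ≤ e) (a b : ℂ) (x y : ℕ → ℂ)
    (hne : ¬ (a = 0 ∧ b = 0 ∧ ∀ i < k, x i = 0 ∧ y i = 0)) :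
    ¬ ( b * (((e : ℂ) + 2) * a ^ (e + 1) + b ^ (e + 1)) = 0 ∧
        a * (a ^ (e + 1) + ((e : ℂ) + 2) * b ^ (e + 1)) = 0 ∧
        (∀ i < k, ((e : ℂ) + 2) * x i ^ (e + 1) * y i = 0) ∧
        (∀ j < k, x j ^ (e + 2) + ((e : ℂ) + 3) * y j ^ (e + 2) = 0) ) := by
  rintro ⟨Ha, Hb, Hx, Hy⟩
  -- the sup norm m over the 2k+2 coordinates and an index attaining it
  let f : ℕ → ℝ := fun n => if n = 0 then ‖a‖ else if n = 1 then ‖b‖ else if n < k + 2 then ‖x (n - 2)‖ else ‖y (n - 2 - k)‖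
  obtain ⟨n₀, hn₀, hmax⟩ := Finset.exists_max_image (Finset.range (2 * k + 2)) f ⟨0, by simp⟩
  have hn₀' : n₀ < 2 * k + 2 := Finset.mem_range.mp hn₀
  have key : ∀ n, n < 2 * k + 2 → f n ≤ f n₀ := fun n hn => hmax n (Finset.mem_range.mpr hn)
  generalize hm_def : f n₀ = m at key
  have hA : ‖a‖ ≤ m := by have h := key 0 (by omega); simpa [f] using h
  have hB : ‖b‖ ≤ m := by have h := key 1 (by omega); simpa [f] using h
  have hX : ∀ i < k, ‖x i‖ ≤ m := by
    intro i hi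
    have h := key (i + 2) (by omega)
    simp only [f, show ¬ (i + 2 = 0) from by omega, show ¬ (i + 2 = 1) from by omega, show i + 2 < k + 2 from by omega,
      if_false, if_true, Nat.add_sub_cancel] at h
    exact h
  have hY : ∀ i < k, ‖y i‖ ≤ m := by
    intro i hi
    have h := key (i + 2 + k) (by omega)
    simp only [f, show ¬ (i + 2 + k = 0) from by omega, show ¬ (i + 2 + k = 1) from by omega,
      show ¬ (i + 2 + k < k + 2) from by omega, if_false, show i + 2 + k - 2 - k = i from by omega] at h
    exact h
  have hm : 0 < m := by
    by_contra hle
    have hle' : m ≤ 0 := not_lt.mp hle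
    exact hne ⟨norm_le_zero_iff.mp (hA.trans hle'), norm_le_zero_iff.mp (hB.trans hle'),
      fun i hi => ⟨norm_le_zero_iff.mp ((hX i hi).trans hle'), norm_le_zero_iff.mp ((hY i hi).trans hle')⟩⟩
  have hc : (0 : ℝ) < m ^ (e + 2) := pow_pos hm _
  have habs : ∀ z : ℂ, z = 0 → ¬ ((1 / 2) * m ^ (e + 2) ≤ ‖z‖) := by
    intro z hz h; rw [hz, norm_zero] at h; linarith
  rcases Nat.lt_or_ge n₀ 2 with h01 | h2
  · have hab : ‖a‖ = m ∨ ‖b‖ = m := by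
      interval_cases n₀
      · left; simpa [f] using hm_def
      · right; simpa [f] using hm_def
    rcases block_ab_scaled e he a b m hm hA hB hab with h | h
    · exact habs _ Ha h
    · exact habs _ Hb h
  · rcases Nat.lt_or_ge n₀ (k + 2) with hx' | hy'
    · have hi : n₀ - 2 < k := by omega
      have h1 : ‖x (n₀ - 2)‖ = m := by
        simp only [f, show ¬ (n₀ = 0) from by omega, show ¬ (n₀ = 1) from by omega, hx', if_false, if_true] at hm_def
        exact hm_def
      rcases block_xy_scaled e he (x (n₀ - 2)) (y (n₀ - 2)) m hm (hX _ hi) (hY _ hi) (Or.inl h1) with h | h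
      · exact habs _ (Hx _ hi) h
      · exact habs _ (Hy _ hi) h
    · have hi : n₀ - 2 - k < k := by omega
      have h1 : ‖y (n₀ - 2 - k)‖ = m := by
        simp only [f, show ¬ (n₀ = 0) from by omega, show ¬ (n₀ = 1) from by omega, show ¬ (n₀ < k + 2) from by omega,
          if_false] at hm_def
        exact hm_def
      rcases block_xy_scaled e he (x (n₀ - 2 - k)) (y (n₀ - 2 - k)) m hm (hX _ hi) (hY _ hi) (Or.inr h1) with h | h
      · exact habs _ (Hx _ hi) h
      · exact habs _ (Hy _ hi) h

end Summit.HodgeConjecture.HodgeConjecture.HodgeLocus.Census.SigmaFamilySmoothRowsP
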